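import Literature.Probability.RandomPlanarGeometry.SAWPulledLargeForceExpansionZdCostPolynomial
import Literature.Probability.RandomPlanarGeometry.SAWPulledLargeForceExpansionZdHeights
import HarnessLib

/-!
# Pulled SAW on `ℤ^{d+1}`: the TOP SYMBOL of the cost census and the DEGREE DROP of `c_k^{(d)}` in the dimension

Topic `Literature/Probability/RandomPlanarGeometry` (continues `SAWPulledLargeForceExpansionZdCostPolynomial.lean`: the axis-class
identity `costCoeffZd_eq_sum_choose_mul`, `N_{c,n}(ℤ^{d+1}) = Σ_{u ≤ c} C(d,u) · F_{c,n}(u)` with `F_{c,n}(u)` the number of cost-`c`,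
length-`n` irreducible bridges of `ℤ^{u+1}` using every lateral axis, and `exists_polynomial_largeForceCoeffZd`: `c_k^{(d)} =
largeForceCoeffZd d k` is a polynomial in `d` of degree `≤ k`; uses `SAWPulledLargeForceExpansionZdHeights.lean`:
`not_irreducible_of_monotone`; and the tree's cost-series engine `CostSeries.Pz / A / E`, `CostSeries.e`).

PRINTED CONTEXT (locators only; nothing below is quoted digit-for-digit). Madras–Slade (1993) §1.1 eq. (1.1.8) p. 5 (the `1/d`
expansion of `μ`) and §4.2 eq. (4.2.20)–(4.2.22) (cost = length − span of a bridge); Duminil-Copin–Hammond (2013) §2.2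
(irreducible bridges, renewal times). NOT IN PRINT (lane statements, new in writing as far as the lane's search found): everything below.

PART I — THE TOP AXIS CLASS (`F_{c,n}(c)`, the coefficient of `C(d,c)`, which alone carries degree `c` in `d`):
* ★ `two_add_le_costZd_of_down` — a self-avoiding walk of `ℤ^{u+1}` using all `u` lateral axes, making at least one DOWN step and
  ending at non-negative height has cost `≥ u + 2`;
* ★★ `card_topAxesClass_eq_zero_of_ne` — `F_{c,n}(c) = 0` for `n ≠ c + 1` (no down step is affordable, so the height profile is
  monotone, so the bridge has span `1` by `not_irreducible_of_monotone`); ★ `apply_zero_eq_one_of_topAxesClass` (height `≡ 1`);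
* ★★★ `card_topAxesClass_self` — `F_{c,c+1}(c) = 2^c · c!`: the class is exactly `+e₀` followed by the `c` lateral unit steps in some
  ORDER of the axes with some SIGNS (bijection with `(Fin c ↪ Fin c) × (Fin c → Bool)` through an inline model walk — no definition).
PART II — TOP SYMBOLS (inline predicate `∃ P, natDegree ≤ m ∧ P.coeff m = a ∧ ∀ d, f d = P.eval d`):
* ★ `exists_polynomial_costCoeffZd_topCoeff` — the `d^c`-coefficient of `N_{c,n}(ℤ^{d+1})` is `2^c · [n = c + 1]`;
* ★ `exists_symbol_coeff_A` — for every `K` the coefficients `[X^i] A_K`, `i ≤ K`, of the engine fed with the census of `ℤ^{d+1}` have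
  `d^i`-coefficient `(−2)^i`: at top degree the fixed point is `U = 1/(1 + 2X)` (the symbol recursion `σ ↦ 1 − Σ_c 2^c X^c σ^{c+1}` is
  solved in `ℚ⟦X⟧` modulo `X^{K+2}`, `alg_A_step`);
* ★★ `exists_polynomial_largeForceCoeffZd_topCoeff_zero` — the `d^k`-coefficient of `c_k^{(d)}` vanishes for `k ≥ 2` (at top degree
  `Σ_j (1 − U)^j = 1/U = 1 + 2X`, `alg_E`);
* ★★★ `exists_polynomial_largeForceCoeffZd_degree_le_pred` — THE DEGREE DROP: for every `k ≥ 2`, `d ↦ c_k^{(d)}` is a polynomial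
  over `ℚ` of degree `≤ k − 1`. (The lane's data show degree EXACTLY `k − 1` with leading coefficient `(−2)^{k−1}` for `2 ≤ k ≤ 7`;
  the exact leading coefficient is the next symbol order and is not addressed here.)
[cite: MadrasSlade1993, §1.1 eq. (1.1.8) p. 5; §4.2 eq. (4.2.20)–(4.2.22)] [cite: DuminilCopinHammond2013, §2.2]

Provenance: lane «pcv-sawmu», a-p1 g17 (2026-08-25). Data (not used; Part I was read off it first): `F_{4,6}(4) = F_{5,7}(5) = F_{6,8}(6)
= F_{6,9}(6) = F_{7,9}(7) = F_{7,10}(7) = 0`, `F_{c,c+1}(c) = 2^c c!` for `c ≤ 7` (HOME FINDING-ZD-AXIS-CLASSES.md); `c_k^{(d)}` of degree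
`k − 1` for `2 ≤ k ≤ 7` (lane PLAN, Question (a)).
-/

noncomputable section

open Finset
open scoped BigOperators
open Literature.Probability.LatticeModels
open Literature.Probability.RandomPlanarGeometry.SAW

namespace Literature.Probability.RandomPlanarGeometry.SAW.Zd

section TopClass

variable {u n : ℕ}

/-- The steps of a self-avoiding walk are unit coordinate vectors `± e_j`. [cite: MadrasSlade1993, §1.1 (p. 1); lane plumbing] -/
private theorem exists_step_single {D : ℕ} {ω : ℕ → Site D} (hω : ω ∈ saws D n) {k : ℕ} (hk : k < n) :
    ∃ j : Fin D, ∃ s : ℤ, (s = 1 ∨ s = -1) ∧ ω (k + 1) - ω k = Pi.single j s := by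
  obtain ⟨j, hj | hj⟩ := (zdGraph_adj_iff_sub _ _).1 ((mem_saws.1 hω).2.2.1 k hk)
  · exact ⟨j, 1, Or.inl rfl, hj⟩
  · refine ⟨j, -1, Or.inr rfl, ?_⟩
    rw [Pi.single_neg, ← hj, neg_sub]

/-- One step changes exactly one coordinate. [cite: MadrasSlade1993, §1.1 (p. 1); lane plumbing] -/
private theorem step_coord_unique {D : ℕ} {ω : ℕ → Site D} (hω : ω ∈ saws D n) {k : ℕ} (hk : k < n) {a b : Fin D}
    (ha : ω (k + 1) a ≠ ω k a) (hb : ω (k + 1) b ≠ ω k b) : a = b := by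
  obtain ⟨j, s, -, hjs⟩ := exists_step_single hω hk
  have key : ∀ e : Fin D, ω (k + 1) e ≠ ω k e → e = j := by
    intro e he
    by_contra hej
    have h := congrFun hjs e
    rw [Pi.sub_apply, Pi.single_eq_of_ne hej] at h
    exact he (sub_eq_zero.1 h)
  exact (key a ha).trans (key b hb).symm

/-- One step changes the first coordinate by at most one. [cite: MadrasSlade1993, §1.1 (p. 1); lane plumbing] -/
private theorem step_apply_zero_le_one {D : ℕ} [NeZero D] {ω : ℕ → Site D} (hω : ω ∈ saws D n) {k : ℕ} (hk : k < n) :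
    ω (k + 1) 0 - ω k 0 ≤ 1 :=
  (le_abs_self _).trans (abs_sub_le_one_of_adj ((mem_saws.1 hω).2.2.1 k hk) 0)

/-- A coordinate that is nonzero at some time was changed by an earlier step. [cite: MadrasSlade1993, §1.1 (p. 1); lane plumbing] -/
private theorem exists_step_ne {D : ℕ} {ω : ℕ → Site D} (h0 : ω 0 = 0) {a : Fin D} {i : ℕ} (hi : ω i a ≠ 0) :
    ∃ k < i, ω (k + 1) a ≠ ω k a := by
  induction i with
  | zero => exact absurd (by rw [h0]; rfl) hi
  | succ i ih =>
    by_cases h : ω (i + 1) a = ω i a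
    · obtain ⟨k, hk, hne⟩ := ih (by rwa [h] at hi)
      exact ⟨k, by omega, hne⟩
    · exact ⟨i, by omega, h⟩

/-- Height accounting: if a walk of `ℤ^{u+1}` uses every lateral axis, its final height plus `u`, plus `2` if some step goes DOWN, is at
most its length. [cite: MadrasSlade1993, §4.2, eq. (4.2.20)–(4.2.22) (cost = length − span); lane lemma] -/
private theorem height_add_le {ω : ℕ → Site (u + 1)} (hω : ω ∈ saws (u + 1) n)
    (hall : ∀ a : Fin (u + 1), a ≠ 0 → ∃ i ≤ n, ω i a ≠ (0 : ℤ)) (δ : ℕ)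
    (hδ : δ = 0 ∨ (δ = 2 ∧ ∃ i < n, ω (i + 1) 0 < ω i 0)) : ω n 0 + u + δ ≤ n := by
  classical
  have h0 : ω 0 = 0 := (mem_saws.1 hω).1
  set Z := (Finset.range n).filter (fun k => ω (k + 1) 0 = ω k 0) with hZ
  set J := (Finset.range n).filter (fun k => ¬ ω (k + 1) 0 = ω k 0) with hJ
  have hZJ : Z.card + J.card = n := by
    rw [hZ, hJ, Finset.card_filter_add_card_filter_not, Finset.card_range]
  -- (1) every used lateral axis owns a lateral step, injectively
  have hch : ∀ a : Fin (u + 1), a ≠ 0 → ∃ k, k < n ∧ ω (k + 1) a ≠ ω k a := by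
    intro a ha
    obtain ⟨i, hi, hne⟩ := hall a ha
    obtain ⟨k, hk, hk'⟩ := exists_step_ne h0 hne
    exact ⟨k, by omega, hk'⟩
  have h1 : u ≤ Z.card := by
    have hU : ((Finset.univ : Finset (Fin (u + 1))).filter (fun a => a ≠ 0)).card = u := by
      rw [Finset.filter_ne' Finset.univ (0 : Fin (u + 1)), Finset.card_erase_of_mem (Finset.mem_univ _),
        Finset.card_univ, Fintype.card_fin, Nat.add_sub_cancel]
    rw [← hU]
    refine Finset.card_le_card_of_injOn (fun a => if h : a ≠ 0 then Classical.choose (hch a h) else 0) ?_ ?_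
    · intro a ha
      rw [Finset.mem_coe, Finset.mem_filter] at ha
      have ha0 : a ≠ 0 := ha.2
      obtain ⟨hk, hne⟩ := Classical.choose_spec (hch a ha0)
      simp only [dif_pos ha0, Finset.mem_coe]
      rw [hZ, Finset.mem_filter, Finset.mem_range]
      refine ⟨hk, ?_⟩
      by_contra h00
      exact ha0 (step_coord_unique hω hk hne h00)
    · intro a ha b hb hab
      rw [Finset.mem_coe, Finset.mem_filter] at ha hb
      have ha0 : a ≠ 0 := ha.2
      have hb0 : b ≠ 0 := hb.2
      simp only [ha0, hb0, ne_eq, not_false_eq_true, dif_pos] at hab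
      obtain ⟨hk, hne⟩ := Classical.choose_spec (hch a ha0)
      obtain ⟨-, hne'⟩ := Classical.choose_spec (hch b hb0)
      rw [hab] at hne
      exact step_coord_unique hω (Classical.choose_spec (hch b hb0)).1 hne hne'
  -- (2) the final height is at most the number of vertical steps, minus two if one of them goes down
  have htel : ω n 0 = ∑ k ∈ J, (ω (k + 1) 0 - ω k 0) := by
    have h := Finset.sum_range_sub (fun k => ω k 0) n
    rw [h0] at h
    simp only [Pi.zero_apply, sub_zero] at h
    rw [← h, ← Finset.sum_filter_add_sum_filter_not (Finset.range n) (fun k => ω (k + 1) 0 = ω k 0)]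
    have hZ0 : ∑ k ∈ Z, (ω (k + 1) 0 - ω k 0) = 0 :=
      Finset.sum_eq_zero fun k hk => by rw [(Finset.mem_filter.1 hk).2, sub_self]
    rw [← hZ, ← hJ, hZ0, zero_add]
  have h2 : ω n 0 + δ ≤ (J.card : ℤ) := by
    rcases hδ with rfl | ⟨rfl, i, hi, hdown⟩
    · rw [Nat.cast_zero, add_zero, htel]
      calc ∑ k ∈ J, (ω (k + 1) 0 - ω k 0) ≤ ∑ _k ∈ J, (1 : ℤ) :=
            Finset.sum_le_sum fun k hk => step_apply_zero_le_one hω (Finset.mem_range.1 (Finset.mem_filter.1 hk).1)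
        _ = (J.card : ℤ) := by simp
    · have hiJ : i ∈ J := by
        rw [hJ, Finset.mem_filter, Finset.mem_range]; exact ⟨hi, fun h => by rw [h] at hdown; exact lt_irrefl _ hdown⟩
      rw [htel, ← Finset.add_sum_erase J _ hiJ]
      have hrest : ∑ k ∈ J.erase i, (ω (k + 1) 0 - ω k 0) ≤ ((J.erase i).card : ℤ) := by
        calc ∑ k ∈ J.erase i, (ω (k + 1) 0 - ω k 0) ≤ ∑ _k ∈ J.erase i, (1 : ℤ) :=
              Finset.sum_le_sum fun k hk =>
                step_apply_zero_le_one hω (Finset.mem_range.1 (Finset.mem_filter.1 (Finset.mem_of_mem_erase hk)).1)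
          _ = ((J.erase i).card : ℤ) := by simp
      have hcard : ((J.erase i).card : ℤ) = J.card - 1 := by
        rw [Finset.card_erase_of_mem hiJ, Nat.cast_sub (Finset.card_pos.2 ⟨i, hiJ⟩)]; simp
      have hstep : ω (i + 1) 0 - ω i 0 ≤ -1 := by
        have := abs_sub_le_one_of_adj ((mem_saws.1 hω).2.2.1 i hi) 0
        omega
      push_cast
      linarith
  -- (3) conclude
  have h3 : (u : ℤ) ≤ Z.card := by exact_mod_cast h1
  have h4 : (Z.card : ℤ) + J.card = n := by exact_mod_cast hZJ
  linarith

/-- ★ A self-avoiding walk of `ℤ^{u+1}` that uses every lateral axis, makes a down step and ends at non-negative height has cost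
`≥ u + 2` (in general: final height `+ u + 2 ≤` length).
[cite: MadrasSlade1993, §4.2, eq. (4.2.20)–(4.2.22) (cost = length − span); lane lemma] -/
theorem two_add_le_costZd_of_down {ω : ℕ → Site (u + 1)} (hω : ω ∈ saws (u + 1) n)
    (hall : ∀ a : Fin (u + 1), a ≠ 0 → ∃ i ≤ n, ω i a ≠ (0 : ℤ)) (hdown : ∃ i < n, ω (i + 1) 0 < ω i 0)
    (hpos : 0 ≤ ω n 0) : u + 2 ≤ costZd u n ω := by
  have h := height_add_le hω hall 2 (Or.inr ⟨rfl, hdown⟩)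
  have h3 : (ω n 0).toNat + u + 2 ≤ n := by
    have : ((ω n 0).toNat : ℤ) = ω n 0 := Int.toNat_of_nonneg hpos
    omega
  unfold costZd
  omega

/-- ★★ THE TOP AXIS CLASS IS EMPTY OFF THE SPAN-ONE CELL: an irreducible bridge of `ℤ^{c+1}` of cost `c` that uses all `c` lateral axes
has length exactly `c + 1` — so `F_{c,n}(c) = 0` for `n ≠ c + 1` in the lane's axis-class identity. Route: no down step is affordable
(`two_add_le_costZd_of_down`), so the height profile is non-decreasing, so the bridge has span `1` (`not_irreducible_of_monotone`),
and cost `c = n − 1`. [cite: MadrasSlade1993, §1.1 eq. (1.1.8) p. 5; §4.2; lane theorem] -/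
theorem card_topAxesClass_eq_zero_of_ne {c n : ℕ} (hn : n ≠ c + 1) :
    ((irreducibleBridges (c + 1) n).filter fun (ω : ℕ → Site (c + 1)) => costZd c n ω = c ∧
        ∀ a : Fin (c + 1), a ≠ 0 → ∃ i ≤ n, ω i a ≠ (0 : ℤ)).card = 0 := by
  rw [Finset.card_eq_zero, Finset.filter_eq_empty_iff]
  rintro ω hω ⟨hcost, hall⟩
  have hbr := (mem_irreducibleBridges.1 hω).1
  have hirr := (mem_irreducibleBridges.1 hω).2
  have hsaw : ω ∈ saws (c + 1) n := (mem_bridges.1 hbr).1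
  have hB : IsBridge n ω := (mem_bridges.1 hbr).2
  have h0 : ω 0 = 0 := (mem_saws.1 hsaw).1
  have hn1 : 1 ≤ n := hirr.1
  -- no down step
  have hx0 : 0 < ω n 0 := by
    have := (hB n hn1 le_rfl).1
    rwa [h0, Pi.zero_apply] at this
  have hmono : ∀ i < n, ω i 0 ≤ ω (i + 1) 0 := by
    intro i hi
    by_contra hlt
    have := two_add_le_costZd_of_down hsaw hall ⟨i, hi, lt_of_not_ge hlt⟩ hx0.le
    omega
  -- hence span one
  have hx1 : ω n 0 ≤ 1 := by
    by_contra h2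
    exact not_irreducible_of_monotone c hω hmono (by omega)
  have hx : ω n 0 = 1 := le_antisymm hx1 hx0
  unfold costZd at hcost
  rw [hx] at hcost
  simp at hcost
  omega

/-- ★ …and such a bridge lives at height `1` from its first step on: `ω i 0 = 1` for `1 ≤ i ≤ n` (it is `+e₀` followed by a self-avoiding
walk of the hyperplane `{x₀ = 1}` using every lateral axis). [cite: MadrasSlade1993, §4.2 (bridges of span one); lane corollary] -/
theorem apply_zero_eq_one_of_topAxesClass {c n : ℕ} {ω : ℕ → Site (c + 1)} (hω : ω ∈ irreducibleBridges (c + 1) n)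
    (hcost : costZd c n ω = c) (hall : ∀ a : Fin (c + 1), a ≠ 0 → ∃ i ≤ n, ω i a ≠ (0 : ℤ)) {i : ℕ} (hi1 : 1 ≤ i) (hin : i ≤ n) :
    ω i 0 = 1 := by
  have hbr := (mem_irreducibleBridges.1 hω).1
  have hsaw : ω ∈ saws (c + 1) n := (mem_bridges.1 hbr).1
  have hB : IsBridge n ω := (mem_bridges.1 hbr).2
  have h0 : ω 0 = 0 := (mem_saws.1 hsaw).1
  have hlo : 0 < ω i 0 := by
    have := (hB i hi1 hin).1
    rwa [h0, Pi.zero_apply] at this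
  have hhi : ω i 0 ≤ ω n 0 := (hB i hi1 hin).2
  have hmono : ∀ i < n, ω i 0 ≤ ω (i + 1) 0 := by
    intro i hi
    by_contra hlt
    have := two_add_le_costZd_of_down hsaw hall ⟨i, hi, lt_of_not_ge hlt⟩ (by omega)
    omega
  have hx1 : ω n 0 ≤ 1 := by
    by_contra h2
    exact not_irreducible_of_monotone c hω hmono (by omega)
  omega

end TopClass


/-! ### The top class on the span-one cell: `F_{c,c+1}(c) = 2^c · c!`

The MODEL WALK of a pair `p = (e, ε)` (`e : Fin c ↪ Fin c` an order of the lateral axes, `ε : Fin c → Bool` signs) is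
`j ↦ 0` at `j = 0` and `e₀ + Σ_{i : i+1 < j} (±1)·e_{1+e(i)}` at `j ≥ 1`: the walk `+e₀, ±e_{1+e(0)}, …, ±e_{1+e(c-1)}`. The lemmas
below take a walk `ω` together with the hypothesis `hω : ∀ j, ω j = (model of p at j)` (no definition is introduced). -/

section TopCount

variable {c : ℕ}

/-- Coordinate `0` of the model walk is `1` from time `1` on. [cite: MadrasSlade1993, §4.2 (bridges of span one); lane plumbing] -/
private theorem model_apply_zero {ω : ℕ → Site (c + 1)} (p : (Fin c ↪ Fin c) × (Fin c → Bool))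
    (hω : ∀ j : ℕ, ω j = if j = 0 then (0 : Site (c + 1)) else
      Pi.single (0 : Fin (c + 1)) (1 : ℤ) + ∑ i ∈ Finset.univ.filter (fun i : Fin c => (i : ℕ) + 1 < j),
        Pi.single (Fin.succ (p.1 i)) (if p.2 i then (1 : ℤ) else -1)) {j : ℕ} (hj : j ≠ 0) : ω j 0 = 1 := by
  rw [hω j, if_neg hj, Pi.add_apply, Pi.single_eq_same, Finset.sum_apply,
    Finset.sum_eq_zero fun i _ => Pi.single_eq_of_ne (Fin.succ_ne_zero _).symm _, add_zero]

/-- Lateral coordinate `1 + e(i)` of the model walk at time `j ≥ 1`: `± 1` if `i + 1 < j`, else `0`.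
[cite: MadrasSlade1993, §4.2 (bridges of span one); lane plumbing] -/
private theorem model_apply_succ {ω : ℕ → Site (c + 1)} (p : (Fin c ↪ Fin c) × (Fin c → Bool))
    (hω : ∀ j : ℕ, ω j = if j = 0 then (0 : Site (c + 1)) else
      Pi.single (0 : Fin (c + 1)) (1 : ℤ) + ∑ i ∈ Finset.univ.filter (fun i : Fin c => (i : ℕ) + 1 < j),
        Pi.single (Fin.succ (p.1 i)) (if p.2 i then (1 : ℤ) else -1)) {j : ℕ} (hj : j ≠ 0) (i : Fin c) :
    ω j (Fin.succ (p.1 i)) = if (i : ℕ) + 1 < j then (if p.2 i then (1 : ℤ) else -1) else 0 := by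
  rw [hω j, if_neg hj, Pi.add_apply, Pi.single_eq_of_ne (Fin.succ_ne_zero _), zero_add, Finset.sum_apply]
  by_cases hi : (i : ℕ) + 1 < j
  · rw [if_pos hi, Finset.sum_eq_single_of_mem i (by simpa using hi)
      (fun b _ hb => Pi.single_eq_of_ne (fun h => hb (p.1.injective (Fin.succ_injective _ h)).symm) _),
      Pi.single_eq_same]
  · rw [if_neg hi]
    refine Finset.sum_eq_zero fun b hb => Pi.single_eq_of_ne (fun h => ?_) _
    have hbi : b = i := (p.1.injective (Fin.succ_injective _ h)).symm
    rw [hbi] at hb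
    exact hi (by simpa using hb)

/-- The model walk starts at the origin. [cite: MadrasSlade1993, §4.2; lane plumbing] -/
private theorem model_zero {ω : ℕ → Site (c + 1)} (p : (Fin c ↪ Fin c) × (Fin c → Bool))
    (hω : ∀ j : ℕ, ω j = if j = 0 then (0 : Site (c + 1)) else
      Pi.single (0 : Fin (c + 1)) (1 : ℤ) + ∑ i ∈ Finset.univ.filter (fun i : Fin c => (i : ℕ) + 1 < j),
        Pi.single (Fin.succ (p.1 i)) (if p.2 i then (1 : ℤ) else -1)) : ω 0 = 0 := by
  rw [hω 0, if_pos rfl]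

/-- The model walk is frozen from time `c + 1` on. [cite: MadrasSlade1993, §4.2; lane plumbing] -/
private theorem model_frozen {ω : ℕ → Site (c + 1)} (p : (Fin c ↪ Fin c) × (Fin c → Bool))
    (hω : ∀ j : ℕ, ω j = if j = 0 then (0 : Site (c + 1)) else
      Pi.single (0 : Fin (c + 1)) (1 : ℤ) + ∑ i ∈ Finset.univ.filter (fun i : Fin c => (i : ℕ) + 1 < j),
        Pi.single (Fin.succ (p.1 i)) (if p.2 i then (1 : ℤ) else -1)) {j : ℕ} (hj : c + 1 ≤ j) : ω j = ω (c + 1) := by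
  rw [hω j, hω (c + 1), if_neg (by omega), if_neg (by omega)]
  congr 1
  refine Finset.sum_congr ?_ (fun _ _ => rfl)
  ext i
  simp only [Finset.mem_filter, Finset.mem_univ, true_and]
  constructor
  · intro _; omega
  · intro _; omega

/-- The steps of the model walk: `+e₀` first, then `± e_{1+e(j-1)}`. [cite: MadrasSlade1993, §4.2; lane plumbing] -/
private theorem model_step {ω : ℕ → Site (c + 1)} (p : (Fin c ↪ Fin c) × (Fin c → Bool))
    (hω : ∀ j : ℕ, ω j = if j = 0 then (0 : Site (c + 1)) else
      Pi.single (0 : Fin (c + 1)) (1 : ℤ) + ∑ i ∈ Finset.univ.filter (fun i : Fin c => (i : ℕ) + 1 < j),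
        Pi.single (Fin.succ (p.1 i)) (if p.2 i then (1 : ℤ) else -1)) {j : ℕ} (hj1 : 1 ≤ j) (hjc : j - 1 < c) :
    ω (j + 1) - ω j = Pi.single (Fin.succ (p.1 ⟨j - 1, hjc⟩)) (if p.2 ⟨j - 1, hjc⟩ then (1 : ℤ) else -1) := by
  have hsplit : Finset.univ.filter (fun i : Fin c => (i : ℕ) + 1 < j + 1) =
      insert ⟨j - 1, hjc⟩ (Finset.univ.filter (fun i : Fin c => (i : ℕ) + 1 < j)) := by
    ext i
    rw [Finset.mem_insert, Finset.mem_filter, Finset.mem_filter, Fin.ext_iff]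
    simp only [Finset.mem_univ, true_and]
    omega
  have hnot : (⟨j - 1, hjc⟩ : Fin c) ∉ Finset.univ.filter (fun i : Fin c => (i : ℕ) + 1 < j) := by
    rw [Finset.mem_filter]; simp only [Finset.mem_univ, true_and]; omega
  rw [hω (j + 1), hω j, if_neg (by omega), if_neg (by omega), hsplit, Finset.sum_insert hnot]
  abel

/-- The first step of the model walk is `+e₀`. [cite: MadrasSlade1993, §4.2; lane plumbing] -/
private theorem model_step_zero {ω : ℕ → Site (c + 1)} (p : (Fin c ↪ Fin c) × (Fin c → Bool))
    (hω : ∀ j : ℕ, ω j = if j = 0 then (0 : Site (c + 1)) else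
      Pi.single (0 : Fin (c + 1)) (1 : ℤ) + ∑ i ∈ Finset.univ.filter (fun i : Fin c => (i : ℕ) + 1 < j),
        Pi.single (Fin.succ (p.1 i)) (if p.2 i then (1 : ℤ) else -1)) : ω 1 - ω 0 = Pi.single 0 1 := by
  rw [hω 1, hω 0, if_neg one_ne_zero, if_pos rfl, sub_zero]
  have : Finset.univ.filter (fun i : Fin c => (i : ℕ) + 1 < 1) = ∅ := by
    rw [Finset.filter_eq_empty_iff]; intro i _; omega
  rw [this, Finset.sum_empty, add_zero]

/-- ★ The model walks are cost-`c`, length-`c+1` irreducible bridges of `ℤ^{c+1}` using every lateral axis.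
[cite: MadrasSlade1993, §4.2 (bridges of span one); lane lemma] -/
private theorem model_mem {ω : ℕ → Site (c + 1)} (p : (Fin c ↪ Fin c) × (Fin c → Bool))
    (hω : ∀ j : ℕ, ω j = if j = 0 then (0 : Site (c + 1)) else
      Pi.single (0 : Fin (c + 1)) (1 : ℤ) + ∑ i ∈ Finset.univ.filter (fun i : Fin c => (i : ℕ) + 1 < j),
        Pi.single (Fin.succ (p.1 i)) (if p.2 i then (1 : ℤ) else -1)) :
    ω ∈ (irreducibleBridges (c + 1) (c + 1)).filter fun (ω : ℕ → Site (c + 1)) => costZd c (c + 1) ω = c ∧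
        ∀ a : Fin (c + 1), a ≠ 0 → ∃ i ≤ c + 1, ω i a ≠ (0 : ℤ) := by
  have hx : ∀ i, 1 ≤ i → ω i 0 = 1 := fun i hi => model_apply_zero p hω (by omega)
  have hadj : ∀ j < c + 1, (zdGraph (c + 1)).Adj (ω j) (ω (j + 1)) := by
    intro j hj
    rw [zdGraph_adj_iff_sub]
    rcases Nat.eq_zero_or_pos j with rfl | hpos
    · exact ⟨0, Or.inl (model_step_zero p hω)⟩
    · have hjc : j - 1 < c := by omega
      refine ⟨Fin.succ (p.1 ⟨j - 1, hjc⟩), ?_⟩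
      have hs := model_step p hω hpos hjc
      cases hb : p.2 ⟨j - 1, hjc⟩
      · right
        rw [← neg_sub, hs, hb, ← Pi.single_neg]
        simp
      · left
        rw [hs, hb, if_pos rfl]
  -- distinct times give distinct sites
  have hinj : Set.InjOn ω {i | i ≤ c + 1} := by
    intro j hj j' hj' h
    simp only [Set.mem_setOf_eq] at hj hj'
    by_contra hne
    -- reduce to j < j'
    have key : ∀ a b : ℕ, a ≤ c + 1 → b ≤ c + 1 → ω a = ω b → a < b → False := by
      intro a b ha hb hab hlt
      by_cases ha0 : a = 0
      · subst ha0
        have h1 := congrFun hab 0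
        rw [model_zero p hω, hx b (by omega)] at h1
        simp at h1
      · have hac : a - 1 < c := by omega
        have h1 := congrFun hab (Fin.succ (p.1 ⟨a - 1, hac⟩))
        rw [model_apply_succ p hω ha0, model_apply_succ p hω (show b ≠ 0 by omega),
          if_neg (show ¬ ((⟨a - 1, hac⟩ : Fin c) : ℕ) + 1 < a from show ¬ (a - 1 + 1 < a) by omega),
          if_pos (show ((⟨a - 1, hac⟩ : Fin c) : ℕ) + 1 < b from show a - 1 + 1 < b by omega)] at h1
        revert h1
        cases p.2 ⟨a - 1, hac⟩ <;> simp
    rcases lt_or_gt_of_ne hne with hlt | hlt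
    · exact key j j' hj hj' h hlt
    · exact key j' j hj' hj h.symm hlt
  have hsaw : ω ∈ saws (c + 1) (c + 1) :=
    mem_saws.2 ⟨model_zero p hω, fun i hi => model_frozen p hω hi, hadj, hinj⟩
  have hB : IsBridge (c + 1) ω := by
    intro i hi1 _
    rw [hx i hi1, hx (c + 1) (by omega), model_zero p hω]
    exact ⟨by simp, le_rfl⟩
  have hirr : IsIrreducibleBridge (c + 1) ω := by
    refine ⟨by omega, hB, fun k hk1 hk2 hren => ?_⟩
    have h := (hren.2.2 1 le_rfl (by omega)).1
    simp only [add_zero] at h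
    rw [hx k hk1, hx (k + 1) (by omega)] at h
    exact lt_irrefl _ h
  refine Finset.mem_filter.2 ⟨mem_irreducibleBridges.2 ⟨mem_bridges.2 ⟨hsaw, hB⟩, hirr⟩, ?_, ?_⟩
  · rw [costZd, hx (c + 1) (by omega)]; simp
  · intro a ha
    obtain ⟨b, rfl⟩ := Fin.exists_succ_eq.2 ha
    obtain ⟨i, hi⟩ := (Finite.surjective_of_injective p.1.injective) b
    refine ⟨c + 1, le_rfl, ?_⟩
    rw [← hi, model_apply_succ p hω (show c + 1 ≠ 0 by omega) i, if_pos (by omega)]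
    split_ifs <;> norm_num

/-- ★ Injectivity of the model: the walk determines the axis order and the signs. [cite: MadrasSlade1993, §4.2; lane lemma] -/
private theorem model_injective : Function.Injective (fun (p : (Fin c ↪ Fin c) × (Fin c → Bool)) (j : ℕ) =>
    if j = 0 then (0 : Site (c + 1)) else
      Pi.single (0 : Fin (c + 1)) (1 : ℤ) + ∑ i ∈ Finset.univ.filter (fun i : Fin c => (i : ℕ) + 1 < j),
        Pi.single (Fin.succ (p.1 i)) (if p.2 i then (1 : ℤ) else -1)) := by
  intro p q hpq
  set ωp : ℕ → Site (c + 1) := fun j => if j = 0 then (0 : Site (c + 1)) else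
      Pi.single (0 : Fin (c + 1)) (1 : ℤ) + ∑ i ∈ Finset.univ.filter (fun i : Fin c => (i : ℕ) + 1 < j),
        Pi.single (Fin.succ (p.1 i)) (if p.2 i then (1 : ℤ) else -1) with hωp
  set ωq : ℕ → Site (c + 1) := fun j => if j = 0 then (0 : Site (c + 1)) else
      Pi.single (0 : Fin (c + 1)) (1 : ℤ) + ∑ i ∈ Finset.univ.filter (fun i : Fin c => (i : ℕ) + 1 < j),
        Pi.single (Fin.succ (q.1 i)) (if q.2 i then (1 : ℤ) else -1) with hωq
  have hp : ∀ j, ωp j = if j = 0 then (0 : Site (c + 1)) else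
      Pi.single (0 : Fin (c + 1)) (1 : ℤ) + ∑ i ∈ Finset.univ.filter (fun i : Fin c => (i : ℕ) + 1 < j),
        Pi.single (Fin.succ (p.1 i)) (if p.2 i then (1 : ℤ) else -1) := fun j => rfl
  have hq : ∀ j, ωq j = if j = 0 then (0 : Site (c + 1)) else
      Pi.single (0 : Fin (c + 1)) (1 : ℤ) + ∑ i ∈ Finset.univ.filter (fun i : Fin c => (i : ℕ) + 1 < j),
        Pi.single (Fin.succ (q.1 i)) (if q.2 i then (1 : ℤ) else -1) := fun j => rfl
  have heq : ∀ j a, ωp j a = ωq j a := fun j a => congrFun (congrFun hpq j) a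
  -- for each i: at time i + 2 the coordinate succ (p.1 i) of ωp is ± 1, so q uses the same axis no later than p does; symmetric ⇒ equal
  have key : ∀ i : Fin c, p.1 i = q.1 i ∧ p.2 i = q.2 i := by
    intro i
    obtain ⟨i', hi'⟩ := (Finite.surjective_of_injective q.1.injective) (p.1 i)
    -- at time i' + 2, ωq has ± 1 at succ (q.1 i') = succ (p.1 i), hence so does ωp, forcing i + 1 < i' + 2
    have h1 := heq ((i' : ℕ) + 2) (Fin.succ (p.1 i))
    rw [model_apply_succ p hp (by omega) i] at h1
    have h1q : ωq ((i' : ℕ) + 2) (Fin.succ (p.1 i)) = if q.2 i' then (1 : ℤ) else -1 := by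
      rw [← hi', model_apply_succ q hq (by omega) i', if_pos (show (i' : ℕ) + 1 < (i' : ℕ) + 2 by omega)]
    rw [h1q] at h1
    have hle1 : (i : ℕ) + 1 < (i' : ℕ) + 2 := by
      by_contra hh
      rw [if_neg hh] at h1
      revert h1
      cases q.2 i' <;> simp
    -- at time i + 2, ωp has ± 1 at succ (p.1 i), hence so does ωq, forcing i' + 1 < i + 2
    have h2 := heq ((i : ℕ) + 2) (Fin.succ (p.1 i))
    rw [model_apply_succ p hp (by omega) i, if_pos (show (i : ℕ) + 1 < (i : ℕ) + 2 by omega)] at h2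
    have h2q : ωq ((i : ℕ) + 2) (Fin.succ (p.1 i)) =
        if (i' : ℕ) + 1 < (i : ℕ) + 2 then (if q.2 i' then (1 : ℤ) else -1) else 0 := by
      rw [← hi']; exact model_apply_succ q hq (by omega) i'
    rw [h2q] at h2
    have hle2 : (i' : ℕ) + 1 < (i : ℕ) + 2 := by
      by_contra hh
      rw [if_neg hh] at h2
      revert h2
      cases p.2 i <;> simp
    have hii : (i' : ℕ) = (i : ℕ) := by omega
    have hii' : i' = i := Fin.ext hii
    subst hii'
    refine ⟨hi'.symm, ?_⟩
    rw [if_pos hle1] at h1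
    revert h1
    cases p.2 i' <;> cases q.2 i' <;> simp
  have h1 : p.1 = q.1 := by
    ext i; exact congrArg Fin.val (key i).1
  have h2 : p.2 = q.2 := funext fun i => (key i).2
  exact Prod.ext h1 h2

/-- ★ Surjectivity of the model onto the top class: a cost-`c` irreducible bridge of `ℤ^{c+1}` of length `c + 1` using every lateral axis
is `+e₀` followed by `c` lateral unit steps in pairwise distinct axes. [cite: MadrasSlade1993, §4.2 (bridges of span one); lane lemma] -/
private theorem model_surjective {ω : ℕ → Site (c + 1)}
    (hωW : ω ∈ (irreducibleBridges (c + 1) (c + 1)).filter fun (ω : ℕ → Site (c + 1)) => costZd c (c + 1) ω = c ∧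
        ∀ a : Fin (c + 1), a ≠ 0 → ∃ i ≤ c + 1, ω i a ≠ (0 : ℤ)) :
    ∃ p : (Fin c ↪ Fin c) × (Fin c → Bool), ∀ j : ℕ, ω j = if j = 0 then (0 : Site (c + 1)) else
      Pi.single (0 : Fin (c + 1)) (1 : ℤ) + ∑ i ∈ Finset.univ.filter (fun i : Fin c => (i : ℕ) + 1 < j),
        Pi.single (Fin.succ (p.1 i)) (if p.2 i then (1 : ℤ) else -1) := by
  classical
  obtain ⟨hωI, hcost, hall⟩ := Finset.mem_filter.1 hωW
  have hsaw : ω ∈ saws (c + 1) (c + 1) := (mem_bridges.1 (mem_irreducibleBridges.1 hωI).1).1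
  obtain ⟨h0, hend, hadj, -⟩ := mem_saws.1 hsaw
  have hx : ∀ i, 1 ≤ i → i ≤ c + 1 → ω i 0 = 1 := fun i hi1 hi2 => apply_zero_eq_one_of_topAxesClass hωI hcost hall hi1 hi2
  have hfirst : ω 1 = Pi.single 0 1 := by
    have h := eq_add_e0_of_adj c (hadj 0 (by omega)) (by rw [hx 1 le_rfl (by omega), h0]; simp)
    rw [h, h0, zero_add]
  -- the lateral steps: for 1 ≤ j ≤ c, ω (j+1) − ω j = single a_j s_j with a_j ≠ 0, s_j = ± 1 (junk outside the range)
  have hlat : ∀ j : ℕ, ∃ a : Fin (c + 1), ∃ s : ℤ, 1 ≤ j → j ≤ c →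
      a ≠ 0 ∧ (s = 1 ∨ s = -1) ∧ ω (j + 1) - ω j = Pi.single a s := by
    intro j
    by_cases hj : 1 ≤ j ∧ j ≤ c
    · obtain ⟨a, s, hs, has⟩ := exists_step_single hsaw (show j < c + 1 by omega)
      have ha0 : a ≠ 0 := by
        rintro rfl
        have h := congrFun has 0
        rw [Pi.sub_apply, hx (j + 1) (by omega) (by omega), hx j hj.1 (by omega), Pi.single_eq_same] at h
        rcases hs with rfl | rfl <;> norm_num at h
      exact ⟨a, s, fun _ _ => ⟨ha0, hs, has⟩⟩
    · exact ⟨0, 0, fun h1 h2 => absurd ⟨h1, h2⟩ hj⟩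
  choose aOf sOf hspec using hlat
  -- the axis order `e i := aOf (i+1) − 1` and the signs
  have ha0 : ∀ i : Fin c, aOf ((i : ℕ) + 1) ≠ 0 := fun i => (hspec ((i : ℕ) + 1) (by omega) (by omega)).1
  have hval : ∀ i : Fin c, (aOf ((i : ℕ) + 1) : ℕ) - 1 < c := by
    intro i
    have h1 := (aOf ((i : ℕ) + 1)).isLt
    have h2 : (aOf ((i : ℕ) + 1) : ℕ) ≠ 0 := fun h => ha0 i (Fin.ext h)
    omega
  have hsucc : ∀ i : Fin c, Fin.succ (⟨(aOf ((i : ℕ) + 1) : ℕ) - 1, hval i⟩ : Fin c) = aOf ((i : ℕ) + 1) := by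
    intro i
    apply Fin.ext
    have h2 : (aOf ((i : ℕ) + 1) : ℕ) ≠ 0 := fun h => ha0 i (Fin.ext h)
    simp only [Fin.val_succ]
    omega
  -- every lateral axis is the axis of one of the c lateral steps ⇒ the axis map is surjective, hence injective
  have hsurj : Function.Surjective (fun i : Fin c => (⟨(aOf ((i : ℕ) + 1) : ℕ) - 1, hval i⟩ : Fin c)) := by
    intro b
    obtain ⟨t, -, hne⟩ := hall (Fin.succ b) (Fin.succ_ne_zero b)
    obtain ⟨k, hk, hkne⟩ := exists_step_ne h0 hne
    have hk1 : 1 ≤ k := by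
      by_contra hk0
      obtain rfl : k = 0 := by omega
      rw [zero_add, hfirst, h0, Pi.single_eq_of_ne (Fin.succ_ne_zero b), Pi.zero_apply] at hkne
      exact hkne rfl
    have hkc : k ≤ c := by
      by_contra hkc'
      -- beyond time c+1 the walk is frozen
      rw [hend (k + 1) (by omega), hend k (by omega)] at hkne
      exact hkne rfl
    refine ⟨⟨k - 1, by omega⟩, ?_⟩
    apply Fin.succ_injective
    rw [hsucc]
    simp only [Nat.sub_add_cancel hk1]
    -- the step k changes coordinate succ b, and it is single (aOf k) (sOf k)
    by_contra hbk
    have h := congrFun (hspec k hk1 hkc).2.2 (Fin.succ b)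
    rw [Pi.sub_apply, Pi.single_eq_of_ne (Ne.symm hbk)] at h
    exact hkne (sub_eq_zero.1 h)
  have hinj : Function.Injective (fun i : Fin c => (⟨(aOf ((i : ℕ) + 1) : ℕ) - 1, hval i⟩ : Fin c)) :=
    Finite.injective_iff_surjective.2 hsurj
  refine ⟨(⟨fun i => ⟨(aOf ((i : ℕ) + 1) : ℕ) - 1, hval i⟩, hinj⟩, fun i => decide (sOf ((i : ℕ) + 1) = 1)), ?_⟩
  -- the model walk of this pair has the same steps as ω
  set Ω : ℕ → Site (c + 1) := fun j => if j = 0 then (0 : Site (c + 1)) else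
      Pi.single (0 : Fin (c + 1)) (1 : ℤ) + ∑ i ∈ Finset.univ.filter (fun i : Fin c => (i : ℕ) + 1 < j),
        Pi.single (Fin.succ (((⟨fun i => ⟨(aOf ((i : ℕ) + 1) : ℕ) - 1, hval i⟩, hinj⟩ : Fin c ↪ Fin c),
          (fun i : Fin c => decide (sOf ((i : ℕ) + 1) = 1))).1 i))
          (if ((⟨fun i => ⟨(aOf ((i : ℕ) + 1) : ℕ) - 1, hval i⟩, hinj⟩ : Fin c ↪ Fin c),
            (fun i : Fin c => decide (sOf ((i : ℕ) + 1) = 1))).2 i then (1 : ℤ) else -1) with hΩdef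
  have hΩ : ∀ j, Ω j = if j = 0 then (0 : Site (c + 1)) else
      Pi.single (0 : Fin (c + 1)) (1 : ℤ) + ∑ i ∈ Finset.univ.filter (fun i : Fin c => (i : ℕ) + 1 < j),
        Pi.single (Fin.succ (((⟨fun i => ⟨(aOf ((i : ℕ) + 1) : ℕ) - 1, hval i⟩, hinj⟩ : Fin c ↪ Fin c),
          (fun i : Fin c => decide (sOf ((i : ℕ) + 1) = 1))).1 i))
          (if ((⟨fun i => ⟨(aOf ((i : ℕ) + 1) : ℕ) - 1, hval i⟩, hinj⟩ : Fin c ↪ Fin c),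
            (fun i : Fin c => decide (sOf ((i : ℕ) + 1) = 1))).2 i then (1 : ℤ) else -1) := fun j => rfl
  suffices hωΩ : ∀ j, ω j = Ω j by exact hωΩ
  have hsteps : ∀ j < c + 1, Ω (j + 1) - Ω j = ω (j + 1) - ω j := by
    intro j hj
    rcases Nat.eq_zero_or_pos j with rfl | hpos
    · rw [model_step_zero _ hΩ, zero_add, hfirst, h0, sub_zero]
    · have hjc : j - 1 < c := by omega
      rw [model_step _ hΩ hpos hjc, (hspec j hpos (by omega)).2.2]
      have hidx : (⟨j - 1, hjc⟩ : Fin c) = ⟨j - 1, hjc⟩ := rfl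
      simp only [Function.Embedding.coeFn_mk]
      rw [hsucc ⟨j - 1, hjc⟩]
      simp only [Nat.sub_add_cancel hpos, decide_eq_true_eq]
      rcases (hspec j hpos (by omega)).2.1 with hs | hs
      · rw [if_pos hs, hs]
      · rw [if_neg (by rw [hs]; norm_num), hs]
  have hle : ∀ j ≤ c + 1, ω j = Ω j := by
    intro j hj
    induction j with
    | zero => rw [model_zero _ hΩ, h0]
    | succ j ih =>
      have h := hsteps j (by omega)
      rw [sub_eq_iff_eq_add] at h
      rw [h, ← ih (by omega), sub_add_cancel]
  intro j
  by_cases hj : j ≤ c + 1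
  · exact hle j hj
  · rw [model_frozen _ hΩ (show c + 1 ≤ j by omega), hend j (by omega), hle (c + 1) le_rfl]

/-- ★★★ THE TOP CLASS ON THE SPAN-ONE CELL HAS `2^c · c!` MEMBERS: the cost-`c`, length-`c+1` irreducible bridges of `ℤ^{c+1}` using
every lateral axis are exactly `+e₀` followed by the `c` lateral unit steps in some ORDER of the axes with some SIGNS — so in the lane's
axis-class identity the degree-`c` coefficient of `d ↦ N_{c,c+1}(ℤ^{d+1})` is `2^c c!/c! = 2^c` (and `0` on every other cell, previous
section). [cite: MadrasSlade1993, §1.1 eq. (1.1.8) p. 5; §4.2; lane theorem] -/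
theorem card_topAxesClass_self (c : ℕ) :
    ((irreducibleBridges (c + 1) (c + 1)).filter fun (ω : ℕ → Site (c + 1)) => costZd c (c + 1) ω = c ∧
        ∀ a : Fin (c + 1), a ≠ 0 → ∃ i ≤ c + 1, ω i a ≠ (0 : ℤ)).card = 2 ^ c * c.factorial := by
  classical
  have himage : ((irreducibleBridges (c + 1) (c + 1)).filter fun (ω : ℕ → Site (c + 1)) => costZd c (c + 1) ω = c ∧
        ∀ a : Fin (c + 1), a ≠ 0 → ∃ i ≤ c + 1, ω i a ≠ (0 : ℤ)) =
      (Finset.univ : Finset ((Fin c ↪ Fin c) × (Fin c → Bool))).image (fun p (j : ℕ) =>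
        if j = 0 then (0 : Site (c + 1)) else
          Pi.single (0 : Fin (c + 1)) (1 : ℤ) + ∑ i ∈ Finset.univ.filter (fun i : Fin c => (i : ℕ) + 1 < j),
            Pi.single (Fin.succ (p.1 i)) (if p.2 i then (1 : ℤ) else -1)) := by
    ext ω
    constructor
    · intro hω
      obtain ⟨p, hp⟩ := model_surjective hω
      exact Finset.mem_image.2 ⟨p, Finset.mem_univ _, (funext hp).symm⟩
    · intro hω
      obtain ⟨p, -, rfl⟩ := Finset.mem_image.1 hω
      exact model_mem p (fun j => rfl)
  rw [himage, Finset.card_image_of_injective _ model_injective, Finset.card_univ, Fintype.card_prod,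
    Fintype.card_embedding_eq, Fintype.card_fun, Fintype.card_bool, Fintype.card_fin, Nat.descFactorial_self, mul_comm]

end TopCount


/-! ### Top symbols: polynomial-in-`d` functions WITH their degree-`m` coefficient

Inline predicate used below («`f` has degree `≤ m` and top coefficient `a`»):
`∃ P : ℚ[X], P.natDegree ≤ m ∧ P.coeff m = a ∧ ∀ d : ℕ, f d = P.eval d`. -/

section Symbol

/-- Monotonicity: raising the degree bound kills the symbol. [cite: MadrasSlade1993, §1.1 (1.1.8); lane plumbing] -/
private theorem gsc_mono {f : ℕ → ℚ} {m m' : ℕ} {a : ℚ}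
    (h : ∃ P : Polynomial ℚ, P.natDegree ≤ m ∧ P.coeff m = a ∧ ∀ d : ℕ, f d = P.eval (d : ℚ)) (hm : m < m') :
    ∃ P : Polynomial ℚ, P.natDegree ≤ m' ∧ P.coeff m' = 0 ∧ ∀ d : ℕ, f d = P.eval (d : ℚ) := by
  obtain ⟨P, hP, -, hf⟩ := h
  exact ⟨P, hP.trans hm.le, Polynomial.coeff_eq_zero_of_natDegree_lt (lt_of_le_of_lt hP hm), hf⟩

/-- Differences. [cite: MadrasSlade1993, §1.1 (1.1.8); lane plumbing] -/
private theorem gsc_sub {f g : ℕ → ℚ} {m : ℕ} {a b : ℚ}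
    (hf : ∃ P : Polynomial ℚ, P.natDegree ≤ m ∧ P.coeff m = a ∧ ∀ d : ℕ, f d = P.eval (d : ℚ))
    (hg : ∃ P : Polynomial ℚ, P.natDegree ≤ m ∧ P.coeff m = b ∧ ∀ d : ℕ, g d = P.eval (d : ℚ)) :
    ∃ P : Polynomial ℚ, P.natDegree ≤ m ∧ P.coeff m = a - b ∧ ∀ d : ℕ, f d - g d = P.eval (d : ℚ) := by
  obtain ⟨P, hP, hPa, hf⟩ := hf
  obtain ⟨Q, hQ, hQb, hg⟩ := hg
  exact ⟨P - Q, (Polynomial.natDegree_sub_le _ _).trans (max_le hP hQ), by rw [Polynomial.coeff_sub, hPa, hQb],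
    fun d => by rw [hf, hg, Polynomial.eval_sub]⟩

/-- Products: degrees add, symbols multiply. [cite: MadrasSlade1993, §1.1 (1.1.8); lane plumbing] -/
private theorem gsc_mul {f g : ℕ → ℚ} {m m' : ℕ} {a b : ℚ}
    (hf : ∃ P : Polynomial ℚ, P.natDegree ≤ m ∧ P.coeff m = a ∧ ∀ d : ℕ, f d = P.eval (d : ℚ))
    (hg : ∃ P : Polynomial ℚ, P.natDegree ≤ m' ∧ P.coeff m' = b ∧ ∀ d : ℕ, g d = P.eval (d : ℚ)) :
    ∃ P : Polynomial ℚ, P.natDegree ≤ m + m' ∧ P.coeff (m + m') = a * b ∧ ∀ d : ℕ, f d * g d = P.eval (d : ℚ) := by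
  obtain ⟨P, hP, hPa, hf⟩ := hf
  obtain ⟨Q, hQ, hQb, hg⟩ := hg
  exact ⟨P * Q, Polynomial.natDegree_mul_le.trans (add_le_add hP hQ),
    by rw [Polynomial.coeff_mul_add_eq_of_natDegree_le hP hQ, hPa, hQb], fun d => by rw [hf, hg, Polynomial.eval_mul]⟩

/-- Finite sums. [cite: MadrasSlade1993, §1.1 (1.1.8); lane plumbing] -/
private theorem gsc_sum {ι : Type*} (s : Finset ι) {f : ι → ℕ → ℚ} {m : ℕ} {a : ι → ℚ}
    (h : ∀ i ∈ s, ∃ P : Polynomial ℚ, P.natDegree ≤ m ∧ P.coeff m = a i ∧ ∀ d : ℕ, f i d = P.eval (d : ℚ)) :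
    ∃ P : Polynomial ℚ, P.natDegree ≤ m ∧ P.coeff m = ∑ i ∈ s, a i ∧ ∀ d : ℕ, (∑ i ∈ s, f i d) = P.eval (d : ℚ) := by
  classical
  induction s using Finset.induction_on with
  | empty => exact ⟨0, by simp, by simp, fun d => by simp⟩
  | @insert i s hi ih =>
    obtain ⟨P, hP, hPa, hf⟩ := h i (Finset.mem_insert_self i s)
    obtain ⟨Q, hQ, hQa, hg⟩ := ih fun j hj => h j (Finset.mem_insert_of_mem hj)
    refine ⟨P + Q, (Polynomial.natDegree_add_le _ _).trans (max_le hP hQ), ?_, fun d => ?_⟩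
    · rw [Polynomial.coeff_add, hPa, hQa, Finset.sum_insert hi]
    · rw [Finset.sum_insert hi, hf, hg, Polynomial.eval_add]

/-- Pointwise-equal functions. [cite: MadrasSlade1993, §1.1 (1.1.8); lane plumbing] -/
private theorem gsc_congr {f g : ℕ → ℚ} {m : ℕ} {a : ℚ} (hfg : ∀ d, f d = g d)
    (h : ∃ P : Polynomial ℚ, P.natDegree ≤ m ∧ P.coeff m = a ∧ ∀ d : ℕ, f d = P.eval (d : ℚ)) :
    ∃ P : Polynomial ℚ, P.natDegree ≤ m ∧ P.coeff m = a ∧ ∀ d : ℕ, g d = P.eval (d : ℚ) := by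
  obtain ⟨P, hP, hPa, hf⟩ := h
  exact ⟨P, hP, hPa, fun d => by rw [← hfg d, hf d]⟩

/-- The zero function has every degree bound with symbol `0`. [cite: MadrasSlade1993, §1.1 (1.1.8); lane plumbing] -/
private theorem gsc_zero (m : ℕ) :
    ∃ P : Polynomial ℚ, P.natDegree ≤ m ∧ P.coeff m = 0 ∧ ∀ d : ℕ, (0 : ℚ) = P.eval (d : ℚ) :=
  ⟨0, by simp, by simp, fun d => by simp⟩

/-! #### Families of integer polynomials `d ↦ S_d ∈ ℤ[X]` whose coefficients `[X^i] S_d` have degree `≤ i` in `d` with top symbol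
`σ.coeff i` for `i ≤ K` («`S` has symbol polynomial `σ ∈ ℚ[X]` up to order `K`»). -/

/-- The constant family `1` has symbol polynomial `1`. [cite: MadrasSlade1993, §1.1 (1.1.8); lane plumbing] -/
private theorem gsym_one (K : ℕ) : ∀ i ≤ K, ∃ P : Polynomial ℚ, P.natDegree ≤ i ∧ P.coeff i = (1 : Polynomial ℚ).coeff i ∧
    ∀ d : ℕ, ((((1 : Polynomial ℤ)).coeff i : ℤ) : ℚ) = P.eval (d : ℚ) := by
  intro i _
  by_cases hi : i = 0
  · subst hi
    exact ⟨1, by simp, by simp, fun d => by simp⟩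
  · exact ⟨0, by simp, by simp [Polynomial.coeff_one, hi], fun d => by simp [Polynomial.coeff_one, hi]⟩

/-- Products of families multiply symbol polynomials. [cite: MadrasSlade1993, §1.1 (1.1.8); lane plumbing] -/
private theorem gsym_mul {S T : ℕ → Polynomial ℤ} {σ τ : Polynomial ℚ} {K : ℕ}
    (hS : ∀ i ≤ K, ∃ P : Polynomial ℚ, P.natDegree ≤ i ∧ P.coeff i = σ.coeff i ∧
      ∀ d : ℕ, (((S d).coeff i : ℤ) : ℚ) = P.eval (d : ℚ))
    (hT : ∀ i ≤ K, ∃ P : Polynomial ℚ, P.natDegree ≤ i ∧ P.coeff i = τ.coeff i ∧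
      ∀ d : ℕ, (((T d).coeff i : ℤ) : ℚ) = P.eval (d : ℚ)) :
    ∀ i ≤ K, ∃ P : Polynomial ℚ, P.natDegree ≤ i ∧ P.coeff i = (σ * τ).coeff i ∧
      ∀ d : ℕ, (((S d * T d).coeff i : ℤ) : ℚ) = P.eval (d : ℚ) := by
  intro i hi
  have key : ∃ P : Polynomial ℚ, P.natDegree ≤ i ∧ P.coeff i = ∑ x ∈ antidiagonal i, σ.coeff x.1 * τ.coeff x.2 ∧
      ∀ d : ℕ, (∑ x ∈ antidiagonal i, (((S d).coeff x.1 : ℚ)) * ((T d).coeff x.2 : ℚ)) = P.eval (d : ℚ) := by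
    refine gsc_sum _ fun x hx => ?_
    have hx' : x.1 + x.2 = i := mem_antidiagonal.1 hx
    have h := gsc_mul (hS x.1 (by omega)) (hT x.2 (by omega))
    rwa [hx'] at h
  obtain ⟨P, hP, hPa, h⟩ := key
  refine ⟨P, hP, by rw [hPa, Polynomial.coeff_mul], fun d => ?_⟩
  rw [← h d, Polynomial.coeff_mul]
  push_cast
  rfl

/-- Powers of a family. [cite: MadrasSlade1993, §1.1 (1.1.8); lane plumbing] -/
private theorem gsym_pow {S : ℕ → Polynomial ℤ} {σ : Polynomial ℚ} {K : ℕ}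
    (hS : ∀ i ≤ K, ∃ P : Polynomial ℚ, P.natDegree ≤ i ∧ P.coeff i = σ.coeff i ∧
      ∀ d : ℕ, (((S d).coeff i : ℤ) : ℚ) = P.eval (d : ℚ)) (n : ℕ) :
    ∀ i ≤ K, ∃ P : Polynomial ℚ, P.natDegree ≤ i ∧ P.coeff i = (σ ^ n).coeff i ∧
      ∀ d : ℕ, ((((S d) ^ n).coeff i : ℤ) : ℚ) = P.eval (d : ℚ) := by
  induction n with
  | zero => simpa only [pow_zero] using gsym_one K
  | succ n ih =>
    have := gsym_mul (S := fun d => S d ^ n) (T := S) ih hS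
    simpa [pow_succ] using this

/-- Differences of families. [cite: MadrasSlade1993, §1.1 (1.1.8); lane plumbing] -/
private theorem gsym_sub {S T : ℕ → Polynomial ℤ} {σ τ : Polynomial ℚ} {K : ℕ}
    (hS : ∀ i ≤ K, ∃ P : Polynomial ℚ, P.natDegree ≤ i ∧ P.coeff i = σ.coeff i ∧
      ∀ d : ℕ, (((S d).coeff i : ℤ) : ℚ) = P.eval (d : ℚ))
    (hT : ∀ i ≤ K, ∃ P : Polynomial ℚ, P.natDegree ≤ i ∧ P.coeff i = τ.coeff i ∧
      ∀ d : ℕ, (((T d).coeff i : ℤ) : ℚ) = P.eval (d : ℚ)) :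
    ∀ i ≤ K, ∃ P : Polynomial ℚ, P.natDegree ≤ i ∧ P.coeff i = (σ - τ).coeff i ∧
      ∀ d : ℕ, (((S d - T d).coeff i : ℤ) : ℚ) = P.eval (d : ℚ) := by
  intro i hi
  obtain ⟨P, hP, hPa, h⟩ := gsc_sub (hS i hi) (hT i hi)
  refine ⟨P, hP, by rw [hPa, Polynomial.coeff_sub], fun d => ?_⟩
  rw [← h d, Polynomial.coeff_sub]
  push_cast
  rfl

/-- Finite sums of families. [cite: MadrasSlade1993, §1.1 (1.1.8); lane plumbing] -/
private theorem gsym_sum {ι : Type*} (s : Finset ι) {S : ι → ℕ → Polynomial ℤ} {σ : ι → Polynomial ℚ} {K : ℕ}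
    (hS : ∀ j ∈ s, ∀ i ≤ K, ∃ P : Polynomial ℚ, P.natDegree ≤ i ∧ P.coeff i = (σ j).coeff i ∧
      ∀ d : ℕ, (((S j d).coeff i : ℤ) : ℚ) = P.eval (d : ℚ)) :
    ∀ i ≤ K, ∃ P : Polynomial ℚ, P.natDegree ≤ i ∧ P.coeff i = (∑ j ∈ s, σ j).coeff i ∧
      ∀ d : ℕ, (((∑ j ∈ s, S j d).coeff i : ℤ) : ℚ) = P.eval (d : ℚ) := by
  intro i hi
  obtain ⟨P, hP, hPa, h⟩ := gsc_sum s (fun j hj => hS j hj i hi)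
  refine ⟨P, hP, by rw [hPa, Polynomial.finsetSum_coeff], fun d => ?_⟩
  rw [← h d, Polynomial.finsetSum_coeff]
  push_cast
  rfl

/-! #### The symbol of the cost census: the `d^c`-coefficient of `N_{c,n}(ℤ^{d+1})` is `2^c · [n = c + 1]` -/

/-- ★ TOP SYMBOL OF THE COST CENSUS: `d ↦ N_{c,n}(ℤ^{d+1})` is a polynomial of degree `≤ c` whose `d^c`-coefficient is `2^c` if
`n = c + 1` and `0` otherwise (axis-class identity + the top class). [cite: MadrasSlade1993, §1.1 eq. (1.1.8) p. 5; lane theorem] -/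
theorem exists_polynomial_costCoeffZd_topCoeff (c n : ℕ) :
    ∃ P : Polynomial ℚ, P.natDegree ≤ c ∧ P.coeff c = (if n = c + 1 then (2 : ℚ) ^ c else 0) ∧
      ∀ d : ℕ, (costCoeffZd d c n : ℚ) = P.eval (d : ℚ) := by
  classical
  -- the binomial form with the explicit class counts
  set F : ℕ → ℕ := fun u => ((irreducibleBridges (u + 1) n).filter fun (ω : ℕ → Site (u + 1)) => costZd u n ω = c ∧
      ∀ a : Fin (u + 1), a ≠ 0 → ∃ i ≤ n, ω i a ≠ (0 : ℤ)).card with hF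
  have hNF : ∀ d, costCoeffZd d c n = ∑ u ∈ Finset.range (c + 1), d.choose u * F u := fun d =>
    costCoeffZd_eq_sum_choose_mul d c n
  have hFc : (F c : ℚ) = if n = c + 1 then (2 : ℚ) ^ c * c.factorial else 0 := by
    split_ifs with h
    · rw [hF, h]
      exact_mod_cast card_topAxesClass_self c
    · rw [hF]
      exact_mod_cast card_topAxesClass_eq_zero_of_ne h
  refine ⟨∑ u ∈ Finset.range (c + 1), Polynomial.C ((F u : ℚ) / (u.factorial : ℚ)) * descPochhammer ℚ u, ?_, ?_, ?_⟩
  · refine Polynomial.natDegree_sum_le_of_forall_le _ _ fun u hu => ?_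
    calc (Polynomial.C ((F u : ℚ) / (u.factorial : ℚ)) * descPochhammer ℚ u).natDegree
        ≤ (descPochhammer ℚ u).natDegree := Polynomial.natDegree_C_mul_le _ _
      _ = u := descPochhammer_natDegree ℚ u
      _ ≤ c := by simpa [Finset.mem_range, Nat.lt_succ_iff] using hu
  · rw [Polynomial.finsetSum_coeff, Finset.sum_eq_single_of_mem c (Finset.mem_range.2 (Nat.lt_succ_self c))]
    · rw [Polynomial.coeff_C_mul]
      have hmon : (descPochhammer ℚ c).coeff c = 1 := by
        have h := (monic_descPochhammer ℚ c).coeff_natDegree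
        rwa [descPochhammer_natDegree] at h
      rw [hmon, mul_one, hFc]
      have hf : (c.factorial : ℚ) ≠ 0 := by exact_mod_cast c.factorial_ne_zero
      split_ifs
      · field_simp
      · simp
    · intro u hu huc
      rw [Polynomial.coeff_C_mul, Polynomial.coeff_eq_zero_of_natDegree_lt, mul_zero]
      rw [descPochhammer_natDegree]
      have : u < c + 1 := Finset.mem_range.1 hu
      omega
  · intro d
    rw [hNF d, Polynomial.eval_finsetSum]
    push_cast
    refine Finset.sum_congr rfl fun u _ => ?_
    have hf : (u.factorial : ℚ) ≠ 0 := by exact_mod_cast u.factorial_ne_zero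
    rw [Polynomial.eval_mul, Polynomial.eval_C, descPochhammer_eval_eq_descFactorial ℚ d u,
      Nat.descFactorial_eq_factorial_mul_choose, Nat.cast_mul, div_mul_eq_mul_div, mul_div_assoc,
      mul_div_cancel_left₀ _ hf, mul_comm]

/-! #### The symbol polynomials of the approximants `A_K`: `(1 + 2X)⁻¹` to order `K` -/

/-- One recursion step on symbol polynomials: if the family `A_K` has symbol polynomial `σ` up to order `K`, then `A_{K+1}` has symbol
polynomial `1 − Σ_{c=1}^{K+1} 2^c X^c σ^{c+1}` up to order `K + 1` (only the span-one cells `n = c + 1` carry top degree).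
[cite: MadrasSlade1993, §1.1 eq. (1.1.8) p. 5; lane lemma] -/
private theorem gsym_A_succ {K : ℕ} {σ : Polynomial ℚ}
    (hA : ∀ i ≤ K, ∃ P : Polynomial ℚ, P.natDegree ≤ i ∧ P.coeff i = σ.coeff i ∧
      ∀ d : ℕ, (((CostSeries.A (costCoeffZd d) K).coeff i : ℤ) : ℚ) = P.eval (d : ℚ)) :
    ∀ i ≤ K + 1, ∃ P : Polynomial ℚ, P.natDegree ≤ i ∧
      P.coeff i = (1 - ∑ j ∈ Finset.range (K + 1), Polynomial.C ((2 : ℚ) ^ (j + 1)) * Polynomial.X ^ (j + 1) * σ ^ (j + 2)).coeff i ∧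
      ∀ d : ℕ, (((CostSeries.A (costCoeffZd d) (K + 1)).coeff i : ℤ) : ℚ) = P.eval (d : ℚ) := by
  intro i hi
  -- each term `X^{j+1} · P_{j+1}(A_K)`
  have hterm : ∀ j ∈ Finset.range (K + 1), ∃ P : Polynomial ℚ, P.natDegree ≤ i ∧
      P.coeff i = (Polynomial.C ((2 : ℚ) ^ (j + 1)) * Polynomial.X ^ (j + 1) * σ ^ (j + 2)).coeff i ∧ ∀ d : ℕ,
      (((Polynomial.X ^ (j + 1) * (CostSeries.Pz (costCoeffZd d) (j + 1)).comp (CostSeries.A (costCoeffZd d) K)).coeff i : ℤ) : ℚ) =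
        P.eval (d : ℚ) := by
    intro j _
    have hcoef : (Polynomial.C ((2 : ℚ) ^ (j + 1)) * Polynomial.X ^ (j + 1) * σ ^ (j + 2)).coeff i =
        if j + 1 ≤ i then (2 : ℚ) ^ (j + 1) * (σ ^ (j + 2)).coeff (i - (j + 1)) else 0 := by
      rw [mul_assoc, Polynomial.coeff_C_mul, Polynomial.coeff_X_pow_mul']
      split_ifs <;> simp
    by_cases hji : j + 1 ≤ i
    · -- `[X^{i-(j+1)}] P_{j+1}(A_K) = Σ_n N_{j+1,n} · [X^{i-(j+1)}] A_K^n`, symbol `2^{j+1} · [X^{i-(j+1)}] σ^{j+2}`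
      have hsum : ∃ P : Polynomial ℚ, P.natDegree ≤ i ∧
          P.coeff i = ∑ n ∈ Finset.range (2 * (j + 1) + 2),
            (if n = (j + 1) + 1 then (2 : ℚ) ^ (j + 1) else 0) * (σ ^ n).coeff (i - (j + 1)) ∧ ∀ d : ℕ,
          (∑ n ∈ Finset.range (2 * (j + 1) + 2),
            (costCoeffZd d (j + 1) n : ℚ) * (((CostSeries.A (costCoeffZd d) K ^ n).coeff (i - (j + 1)) : ℤ) : ℚ)) =
            P.eval (d : ℚ) := by
        refine gsc_sum _ fun n _ => ?_
        have h := gsc_mul (exists_polynomial_costCoeffZd_topCoeff (j + 1) n)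
          (gsym_pow hA n (i - (j + 1)) (by omega))
        rwa [show j + 1 + (i - (j + 1)) = i by omega] at h
      obtain ⟨P, hP, hPa, h⟩ := hsum
      refine ⟨P, hP, ?_, fun d => ?_⟩
      · rw [hPa, hcoef, if_pos hji, Finset.sum_eq_single_of_mem ((j + 1) + 1)
          (Finset.mem_range.2 (by omega)) (fun n _ hn => by rw [if_neg hn, zero_mul]), if_pos rfl]
      · rw [Polynomial.coeff_X_pow_mul', if_pos hji, ← h d, CostSeries.Pz, Polynomial.sum_comp, Polynomial.finsetSum_coeff]
        push_cast
        refine Finset.sum_congr rfl fun n _ => ?_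
        rw [Polynomial.mul_comp, Polynomial.C_comp, Polynomial.X_pow_comp, Polynomial.coeff_C_mul]
        push_cast
        rfl
    · refine ⟨0, by simp, by rw [hcoef, if_neg hji]; simp, fun d => ?_⟩
      rw [Polynomial.coeff_X_pow_mul', if_neg hji]
      simp
  have hsum := gsc_sum (Finset.range (K + 1)) hterm
  obtain ⟨P, hP, hPa, h⟩ := gsc_sub ((gsym_one (K + 1)) i hi) hsum
  refine ⟨P, hP, ?_, fun d => ?_⟩
  · rw [hPa, Polynomial.coeff_sub, Polynomial.finsetSum_coeff]
  · rw [← h d, CostSeries.A, Polynomial.coeff_sub, Polynomial.finsetSum_coeff]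
    push_cast
    rfl


/-! #### The symbol recursion solved: `(1 + 2X) · ι = 1`, `ι = Σ (−2)^i X^i`, and the truncated identities -/

/-- `(1 + 2X) · Σ_i (−2)^i X^i = 1` in `ℚ⟦X⟧`. [cite: MadrasSlade1993, §1.1 (1.1.8); lane plumbing] -/
private theorem alg_iota_mul :
    (1 + PowerSeries.C (2 : ℚ) * PowerSeries.X) * PowerSeries.mk (fun i : ℕ => (-2 : ℚ) ^ i) = 1 := by
  ext n
  rw [add_mul, one_mul, map_add, PowerSeries.coeff_mk, mul_assoc, PowerSeries.coeff_C_mul, PowerSeries.coeff_one]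
  rcases n with _ | n
  · rw [PowerSeries.coeff_zero_X_mul, mul_zero, add_zero, pow_zero, if_pos rfl]
  · rw [PowerSeries.coeff_succ_X_mul, PowerSeries.coeff_mk, if_neg (Nat.succ_ne_zero n), pow_succ]
    ring

/-- A polynomial whose coefficients up to order `K` are `(−2)^i` agrees with `ι` modulo `X^{K+1}`.
[cite: MadrasSlade1993, §1.1 (1.1.8); lane plumbing] -/
private theorem alg_dvd {K : ℕ} {σ : Polynomial ℚ} (hσ : ∀ i ≤ K, σ.coeff i = (-2 : ℚ) ^ i) :
    (PowerSeries.X : PowerSeries ℚ) ^ (K + 1) ∣ ((σ : PowerSeries ℚ) - PowerSeries.mk (fun i : ℕ => (-2 : ℚ) ^ i)) := by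
  rw [PowerSeries.X_pow_dvd_iff]
  intro m hm
  rw [map_sub, Polynomial.coeff_coe, PowerSeries.coeff_mk, hσ m (by omega), sub_self]

/-- ★ The symbol recursion preserves `(−2)^i`: if `σ ≡ (1+2X)⁻¹ (mod X^{K+1})` then
`1 − Σ_{c=1}^{K+1} 2^c X^c σ^{c+1} ≡ (1+2X)⁻¹ (mod X^{K+2})` — at top degree in `d` the fixed point `U` of the cost series is `1/(1+2X)`.
[cite: MadrasSlade1993, §1.1 eq. (1.1.8) p. 5; lane lemma] -/
private theorem alg_A_step {K : ℕ} {σ : Polynomial ℚ} (hσ : ∀ i ≤ K, σ.coeff i = (-2 : ℚ) ^ i) :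
    ∀ i ≤ K + 1, (1 - ∑ j ∈ Finset.range (K + 1),
      Polynomial.C ((2 : ℚ) ^ (j + 1)) * Polynomial.X ^ (j + 1) * σ ^ (j + 2)).coeff i = (-2 : ℚ) ^ i := by
  intro i hi
  set ι : PowerSeries ℚ := PowerSeries.mk (fun i : ℕ => (-2 : ℚ) ^ i) with hι
  set w : PowerSeries ℚ := 1 - ι with hw
  have hF1 : (1 + PowerSeries.C (2 : ℚ) * PowerSeries.X) * ι = 1 := alg_iota_mul
  have hw2 : PowerSeries.C (2 : ℚ) * PowerSeries.X * ι = w := by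
    rw [hw]; linear_combination hF1
  have hwX : (PowerSeries.X : PowerSeries ℚ) ∣ w := by
    rw [← hw2]; exact Dvd.intro_left (PowerSeries.C (2 : ℚ) * ι) (by ring)
  have hι1 : ι * ∑ j ∈ Finset.range (K + 1), w ^ j = 1 - w ^ (K + 1) := by
    rw [show ι = 1 - w by rw [hw]; ring]; exact mul_neg_geom_sum w (K + 1)
  -- the model sum at the fixed point
  have hT : ∑ j ∈ Finset.range (K + 1), PowerSeries.C ((2 : ℚ) ^ (j + 1)) * PowerSeries.X ^ (j + 1) * ι ^ (j + 2)
      = w - w ^ (K + 2) := by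
    have hterm : ∀ j, PowerSeries.C ((2 : ℚ) ^ (j + 1)) * PowerSeries.X ^ (j + 1) * ι ^ (j + 2) = ι * w * w ^ j := by
      intro j
      rw [← hw2, map_pow]; ring
    rw [Finset.sum_congr rfl (fun j _ => hterm j), ← Finset.mul_sum]
    calc ι * w * ∑ j ∈ Finset.range (K + 1), w ^ j = w * (ι * ∑ j ∈ Finset.range (K + 1), w ^ j) := by ring
      _ = w * (1 - w ^ (K + 1)) := by rw [hι1]
      _ = w - w ^ (K + 2) := by ring
  -- the polynomial, mapped to power series
  have hQ : (((1 - ∑ j ∈ Finset.range (K + 1), Polynomial.C ((2 : ℚ) ^ (j + 1)) * Polynomial.X ^ (j + 1) * σ ^ (j + 2) :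
      Polynomial ℚ)) : PowerSeries ℚ) =
      1 - ∑ j ∈ Finset.range (K + 1), PowerSeries.C ((2 : ℚ) ^ (j + 1)) * PowerSeries.X ^ (j + 1) * (σ : PowerSeries ℚ) ^ (j + 2) := by
    rw [← Polynomial.coeToPowerSeries.ringHom_apply, map_sub, map_one, map_sum]
    refine congrArg _ (Finset.sum_congr rfl fun j _ => ?_)
    simp only [map_mul, map_pow, Polynomial.coeToPowerSeries.ringHom_apply, Polynomial.coe_C, Polynomial.coe_X]
  -- the difference with ι is divisible by X^{K+2}
  have hdiff : (PowerSeries.X : PowerSeries ℚ) ^ (K + 2) ∣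
      ((((1 - ∑ j ∈ Finset.range (K + 1), Polynomial.C ((2 : ℚ) ^ (j + 1)) * Polynomial.X ^ (j + 1) * σ ^ (j + 2) :
        Polynomial ℚ)) : PowerSeries ℚ) - ι) := by
    rw [hQ]
    have hsplit : (1 - ∑ j ∈ Finset.range (K + 1), PowerSeries.C ((2 : ℚ) ^ (j + 1)) * PowerSeries.X ^ (j + 1) *
        (σ : PowerSeries ℚ) ^ (j + 2)) - ι =
        w ^ (K + 2) - ∑ j ∈ Finset.range (K + 1), PowerSeries.C ((2 : ℚ) ^ (j + 1)) * PowerSeries.X ^ (j + 1) *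
          ((σ : PowerSeries ℚ) ^ (j + 2) - ι ^ (j + 2)) := by
      have : ∑ j ∈ Finset.range (K + 1), PowerSeries.C ((2 : ℚ) ^ (j + 1)) * PowerSeries.X ^ (j + 1) *
          ((σ : PowerSeries ℚ) ^ (j + 2) - ι ^ (j + 2)) =
          ∑ j ∈ Finset.range (K + 1), PowerSeries.C ((2 : ℚ) ^ (j + 1)) * PowerSeries.X ^ (j + 1) * (σ : PowerSeries ℚ) ^ (j + 2)
          - ∑ j ∈ Finset.range (K + 1), PowerSeries.C ((2 : ℚ) ^ (j + 1)) * PowerSeries.X ^ (j + 1) * ι ^ (j + 2) := by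
        rw [← Finset.sum_sub_distrib]
        exact Finset.sum_congr rfl fun j _ => by ring
      rw [this, hT, hw]; ring
    rw [hsplit]
    refine dvd_sub (pow_dvd_pow_of_dvd hwX _) (Finset.dvd_sum fun j _ => ?_)
    have h1 : (PowerSeries.X : PowerSeries ℚ) ^ (K + 1) ∣ (σ : PowerSeries ℚ) ^ (j + 2) - ι ^ (j + 2) :=
      (alg_dvd hσ).trans (sub_dvd_pow_sub_pow _ _ _)
    have h2 : (PowerSeries.X : PowerSeries ℚ) ^ (K + 2) ∣ PowerSeries.X ^ (j + 1) * ((σ : PowerSeries ℚ) ^ (j + 2) - ι ^ (j + 2)) := by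
      rw [show K + 2 = 1 + (K + 1) by ring, pow_add, pow_one]
      exact mul_dvd_mul (dvd_pow_self _ (Nat.succ_ne_zero j)) h1
    rw [mul_assoc]
    exact dvd_mul_of_dvd_right h2 _
  have hcoeff := (PowerSeries.X_pow_dvd_iff.1 hdiff) i (by omega)
  rw [map_sub, Polynomial.coeff_coe, PowerSeries.coeff_mk, sub_eq_zero] at hcoeff
  exact hcoeff

/-- ★ The inverse series at top degree: if `σ ≡ (1+2X)⁻¹ (mod X^{k+1})` then `Σ_{j ≤ k} (1 − σ)^j ≡ 1 + 2X (mod X^{k+1})`, so its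
`X^k`-coefficient vanishes for `k ≥ 2` — at top degree `1/U = 1 + 2X`. [cite: MadrasSlade1993, §1.1 eq. (1.1.8) p. 5; lane lemma] -/
private theorem alg_E {k : ℕ} {σ : Polynomial ℚ} (hσ : ∀ i ≤ k, σ.coeff i = (-2 : ℚ) ^ i) (hk : 2 ≤ k) :
    (∑ j ∈ Finset.range (k + 1), (1 - σ) ^ j).coeff k = 0 := by
  set ι : PowerSeries ℚ := PowerSeries.mk (fun i : ℕ => (-2 : ℚ) ^ i) with hι
  set w : PowerSeries ℚ := 1 - ι with hw
  have hF1 : (1 + PowerSeries.C (2 : ℚ) * PowerSeries.X) * ι = 1 := alg_iota_mul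
  have hw2 : PowerSeries.C (2 : ℚ) * PowerSeries.X * ι = w := by
    rw [hw]; linear_combination hF1
  have hwX : (PowerSeries.X : PowerSeries ℚ) ∣ w := by
    rw [← hw2]; exact Dvd.intro_left (PowerSeries.C (2 : ℚ) * ι) (by ring)
  have hι1 : ι * ∑ j ∈ Finset.range (k + 1), w ^ j = 1 - w ^ (k + 1) := by
    rw [show ι = 1 - w by rw [hw]; ring]; exact mul_neg_geom_sum w (k + 1)
  -- Σ_j w^j = (1 + 2X)(1 − w^{k+1})
  have hgeom : ∑ j ∈ Finset.range (k + 1), w ^ j =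
      (1 + PowerSeries.C (2 : ℚ) * PowerSeries.X) - (1 + PowerSeries.C (2 : ℚ) * PowerSeries.X) * w ^ (k + 1) := by
    have : ∑ j ∈ Finset.range (k + 1), w ^ j =
        (1 + PowerSeries.C (2 : ℚ) * PowerSeries.X) * (ι * ∑ j ∈ Finset.range (k + 1), w ^ j) := by
      rw [← mul_assoc, hF1, one_mul]
    rw [this, hι1]; ring
  -- the polynomial, mapped to power series
  have hQ : (((∑ j ∈ Finset.range (k + 1), (1 - σ) ^ j : Polynomial ℚ)) : PowerSeries ℚ) =
      ∑ j ∈ Finset.range (k + 1), (1 - (σ : PowerSeries ℚ)) ^ j := by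
    rw [← Polynomial.coeToPowerSeries.ringHom_apply, map_sum]
    refine Finset.sum_congr rfl fun j _ => ?_
    rw [map_pow, map_sub, map_one, Polynomial.coeToPowerSeries.ringHom_apply]
  have hdiff : (PowerSeries.X : PowerSeries ℚ) ^ (k + 1) ∣
      ((((∑ j ∈ Finset.range (k + 1), (1 - σ) ^ j : Polynomial ℚ)) : PowerSeries ℚ) -
        (1 + PowerSeries.C (2 : ℚ) * PowerSeries.X)) := by
    rw [hQ]
    have hsplit : ∑ j ∈ Finset.range (k + 1), (1 - (σ : PowerSeries ℚ)) ^ j - (1 + PowerSeries.C (2 : ℚ) * PowerSeries.X) =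
        ∑ j ∈ Finset.range (k + 1), ((1 - (σ : PowerSeries ℚ)) ^ j - w ^ j) -
          (1 + PowerSeries.C (2 : ℚ) * PowerSeries.X) * w ^ (k + 1) := by
      rw [Finset.sum_sub_distrib, hgeom]; ring
    rw [hsplit]
    refine dvd_sub (Finset.dvd_sum fun j _ => ?_) (dvd_mul_of_dvd_right (pow_dvd_pow_of_dvd hwX _) _)
    have h1 : (1 - (σ : PowerSeries ℚ)) - w = -((σ : PowerSeries ℚ) - ι) := by rw [hw]; ring
    exact ((dvd_neg.2 (alg_dvd hσ)).trans (by rw [← h1]; exact sub_dvd_pow_sub_pow _ _ _))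
  have hcoeff := (PowerSeries.X_pow_dvd_iff.1 hdiff) k (Nat.lt_succ_self k)
  rw [map_sub, Polynomial.coeff_coe, map_add, PowerSeries.coeff_one, PowerSeries.coeff_C_mul, PowerSeries.coeff_X,
    if_neg (by omega), if_neg (by omega), mul_zero, add_zero, sub_zero] at hcoeff
  exact hcoeff

/-! #### Assembly: the symbols of `[X^i] A_K` are `(−2)^i`, and `[X^k] E_k` has symbol `0` for `k ≥ 2` -/

/-- ★ For every `K` there is a symbol polynomial `σ_K ≡ (1+2X)⁻¹ (mod X^{K+1})` of the family `d ↦ A_K(N(ℤ^{d+1}))`: the coefficient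
`[X^i] A_K`, `i ≤ K`, is a polynomial in `d` of degree `≤ i` with `d^i`-coefficient `(−2)^i`.
[cite: MadrasSlade1993, §1.1 eq. (1.1.8) p. 5; lane theorem] -/
theorem exists_symbol_coeff_A (K : ℕ) : ∃ σ : Polynomial ℚ, (∀ i ≤ K, σ.coeff i = (-2 : ℚ) ^ i) ∧
    ∀ i ≤ K, ∃ P : Polynomial ℚ, P.natDegree ≤ i ∧ P.coeff i = σ.coeff i ∧
      ∀ d : ℕ, (((CostSeries.A (costCoeffZd d) K).coeff i : ℤ) : ℚ) = P.eval (d : ℚ) := by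
  induction K with
  | zero =>
    refine ⟨1, fun i hi => ?_, fun i hi => ?_⟩
    · obtain rfl : i = 0 := Nat.le_zero.1 hi; simp
    · exact gsym_one 0 i hi
  | succ K ih =>
    obtain ⟨σ, hσ, hA⟩ := ih
    exact ⟨1 - ∑ j ∈ Finset.range (K + 1), Polynomial.C ((2 : ℚ) ^ (j + 1)) * Polynomial.X ^ (j + 1) * σ ^ (j + 2),
      alg_A_step hσ, gsym_A_succ hA⟩

/-- ★★ `[X^k] E_k = c_k^{(d)}` has degree `≤ k` in `d` with `d^k`-coefficient `0`, for `k ≥ 2`.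
[cite: MadrasSlade1993, §1.1 eq. (1.1.8) p. 5; lane theorem] -/
theorem exists_polynomial_largeForceCoeffZd_topCoeff_zero {k : ℕ} (hk : 2 ≤ k) :
    ∃ P : Polynomial ℚ, P.natDegree ≤ k ∧ P.coeff k = 0 ∧ ∀ d : ℕ, (largeForceCoeffZd d k : ℚ) = P.eval (d : ℚ) := by
  obtain ⟨σ, hσ, hA⟩ := exists_symbol_coeff_A k
  -- the family 1 − A_k has symbol 1 − σ; its powers and their sum
  have h1 : ∀ i ≤ k, ∃ P : Polynomial ℚ, P.natDegree ≤ i ∧ P.coeff i = (1 - σ).coeff i ∧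
      ∀ d : ℕ, (((1 - CostSeries.A (costCoeffZd d) k).coeff i : ℤ) : ℚ) = P.eval (d : ℚ) :=
    gsym_sub (S := fun _ => (1 : Polynomial ℤ)) (gsym_one k) hA
  have hE : ∀ i ≤ k, ∃ P : Polynomial ℚ, P.natDegree ≤ i ∧
      P.coeff i = (∑ j ∈ Finset.range (k + 1), (1 - σ) ^ j).coeff i ∧
      ∀ d : ℕ, (((∑ j ∈ Finset.range (k + 1), (1 - CostSeries.A (costCoeffZd d) k) ^ j).coeff i : ℤ) : ℚ) = P.eval (d : ℚ) :=
    gsym_sum (Finset.range (k + 1)) (S := fun j d => (1 - CostSeries.A (costCoeffZd d) k) ^ j) (σ := fun j => (1 - σ) ^ j)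
      (fun j _ => gsym_pow (S := fun d => 1 - CostSeries.A (costCoeffZd d) k) h1 j)
  obtain ⟨P, hP, hPa, h⟩ := hE k le_rfl
  refine ⟨P, hP, by rw [hPa, alg_E hσ hk], fun d => ?_⟩
  rw [← h d, largeForceCoeffZd, CostSeries.e, CostSeries.E]

/-- ★★★ THE DEGREE DROP: for every `k ≥ 2`, `d ↦ c_k^{(d)} = largeForceCoeffZd d k` is a polynomial over `ℚ` of degree `≤ k − 1`
(not merely `≤ k`): at top degree in `d` the cost series is the geometric series of the span-one cells, `U = 1/(1+2X)`, so
`e^{λ_B} ∼ y/U` has `1/U = 1 + 2X` and every `X^k`, `k ≥ 2`, cancels. This is the lane's observed «degree `k − 1`, leading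
coefficient `(−2)^{k−1}`» phenomenon, first half. [cite: MadrasSlade1993, §1.1 eq. (1.1.8) p. 5; lane theorem] -/
theorem exists_polynomial_largeForceCoeffZd_degree_le_pred {k : ℕ} (hk : 2 ≤ k) :
    ∃ P : Polynomial ℚ, P.natDegree ≤ k - 1 ∧ ∀ d : ℕ, (largeForceCoeffZd d k : ℚ) = P.eval (d : ℚ) := by
  obtain ⟨P, hP, hPk, h⟩ := exists_polynomial_largeForceCoeffZd_topCoeff_zero hk
  refine ⟨P, ?_, h⟩
  by_contra hlt
  have hdeg : P.natDegree = k := le_antisymm hP (by omega)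
  have hP0 : P ≠ 0 := by
    rintro rfl
    simp at hdeg
    omega
  have hlead : P.leadingCoeff = 0 := by rw [Polynomial.leadingCoeff, hdeg, hPk]
  exact hP0 (Polynomial.leadingCoeff_eq_zero.1 hlead)

end Symbol

end Literature.Probability.RandomPlanarGeometry.SAW.Zd
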